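import Summits.Ventures.DiscreteObjects.Hadamard.Order334Nega

/-!
# Hadamard 668 census, family F12 — automorphisms of H(668) of order divisible by 167 have order 167, 334 or 668 (kernel)

Framing: lottery ticket; floor = certified bounds/negative ranges.

Cell pub-namedobj (venture DiscreteObjects), target (H), hadamard gen 12.  Capstone of the `167`-column of the order table.  For a
signed-permutation automorphism `(π, κ, d, e)` of a Hadamard matrix of order `668` whose permutation pair has order `N` with
`167 ∣ N`: **`N ∈ {167, 334, 668}`** (`hadamard668_signedAut_orderOf_of_167_dvd`).  Ingredients, all kernel: every prime divisor
of `N` lies in the spectrum `{2,3,5,7,11,13,23,37,41,83,167}` (`hadamard668_signedAut_prime_mem'`); no product `p · 167` with `p` an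
odd spectrum prime divides `N` (composite-order table, gen 11); `167² ∤ N` (`PrimeSquareOrder`); and — new here —
**`8 · 167 = 1336 ∤ N`** (`no_hadamard668_signedAut_order1336`): an element of order `1336` would have a square of order `668`, whose
row permutation is a single `668`-cycle by `hadamard668_order668_cycle`, but the square of a permutation of `668` points is never a
`668`-cycle.  Hence `N = 167 · 2^v` with `v ≤ 2`.  Together with `hadamard668_fixedRows_167` (order `167`: four free orbits of rows and
of columns — the Goethals–Seidel / four-circulant shape), `hadamard668_signedAut_orderOf_334` (two plus two orbits, nega-cyclic) and
`hadamard668_signedAut_orderOf_668` (one plus one, negacyclic) this classifies the automorphisms of `167`-divisible order of any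
H(668) by orbit shape and signing.  Ours, not literature; no `sorry`.
-/

namespace Summit.Ventures.DiscreteObjects.Hadamard

open Finset BigOperators Matrix

open Literature.Combinatorics.Designs.GoethalsSeidel (IsHadamardMatrix)

variable {ι : Type*} [Fintype ι] [DecidableEq ι]

variable {H : Matrix ι ι ℤ} {π κ : Equiv.Perm ι} {d e : ι → ℤ}

/-- the square of a permutation of `668` points is not a `668`-cycle: if `(σ²)^k` is fixed-point-free for `0 < k < 668` and
`σ^1336 = 1`, contradiction -/
lemma sq_not_cycle668 (hι : Fintype.card ι = 668) (σ : Equiv.Perm ι) (hσ : σ ^ 1336 = 1)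
    (hfree : ∀ i k, 0 < k → k < 668 → ((σ ^ 2) ^ k) i ≠ i) : False := by
  obtain ⟨i₀⟩ : Nonempty ι := by rw [← Fintype.card_pos_iff, hι]; norm_num
  have hσ2 : (σ ^ 2) ^ 668 = 1 := by rw [← pow_mul]; exact hσ
  -- the σ²-orbit of i₀ is everything, so σ i₀ = (σ²)^k i₀ for some k < 668
  have hcard : (orbFin (σ ^ 2) 668 i₀).card = 668 := card_orbFin_of_free (hfree i₀)
  have huniv : orbFin (σ ^ 2) 668 i₀ = univ := Finset.eq_univ_of_card _ (by rw [hcard, hι])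
  have hmem : σ i₀ ∈ orbFin (σ ^ 2) 668 i₀ := by rw [huniv]; exact Finset.mem_univ _
  obtain ⟨k, hk, hki⟩ := Finset.mem_image.mp hmem
  rw [Finset.mem_range] at hk
  rcases Nat.eq_zero_or_pos k with hk0 | hk0
  · -- σ i₀ = i₀ ⇒ σ² i₀ = i₀
    subst hk0
    simp only [pow_zero, Equiv.Perm.one_apply] at hki
    exact hfree i₀ 1 one_pos (by norm_num) (by rw [pow_one, pow_two, Equiv.Perm.mul_apply, ← hki, ← hki])
  · -- σ^(2k) i₀ = σ i₀ ⇒ σ^(2k−1) i₀ = i₀ ⇒ (σ²)^(2k−1) i₀ = i₀ with 2k − 1 odd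
    have h1 : (σ ^ (2 * k - 1)) i₀ = i₀ := by
      apply σ.injective
      rw [← Equiv.Perm.mul_apply, ← pow_succ', show 2 * k - 1 + 1 = 2 * k by omega, pow_mul]
      exact hki
    have h2 : ((σ ^ 2) ^ (2 * k - 1)) i₀ = i₀ := by
      rw [← pow_mul, mul_comm, pow_mul]
      exact perm_pow_apply_of_fixed _ h1 2
    by_cases hlt : 2 * k - 1 < 668
    · exact hfree i₀ (2 * k - 1) (by omega) hlt h2
    · have h3 : ((σ ^ 2) ^ (2 * k - 1 - 668)) i₀ = i₀ := by
        have e1 : (σ ^ 2) ^ (2 * k - 1) = (σ ^ 2) ^ (2 * k - 1 - 668) := by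
          conv_lhs => rw [show 2 * k - 1 = 668 + (2 * k - 1 - 668) by omega, pow_add, hσ2, one_mul]
        rw [← e1]; exact h2
      exact hfree i₀ (2 * k - 1 - 668) (by omega) (by omega) h3

/-- **No automorphism of order 1336.**  `π^1336 = κ^1336 = 1` with `(π^8, κ^8) ≠ (1,1)` and `(π^668, κ^668) ≠ (1,1)` is impossible
(the square would have order `668`, hence be a single `668`-cycle on rows). -/
theorem no_hadamard668_signedAut_order1336 (hH : IsHadamardMatrix H) (hι : Fintype.card ι = 668)
    (haut : IsSignedAut H π κ d e) (hπ : π ^ 1336 = 1) (hκ : κ ^ 1336 = 1)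
    (h8 : π ^ 8 ≠ 1 ∨ κ ^ 8 ≠ 1) (h668 : π ^ 668 ≠ 1 ∨ κ ^ 668 ≠ 1) : False := by
  have haut2 : IsSignedAut H (π ^ 2) (κ ^ 2) (fun i => cyc π d i 2) (fun j => cyc κ e j 2) := isSignedAut_pow haut 2
  have h1 : (π ^ 2) ^ 668 = 1 := by rw [← pow_mul]; exact hπ
  have h2 : (κ ^ 2) ^ 668 = 1 := by rw [← pow_mul]; exact hκ
  have h4 : (π ^ 2) ^ 4 ≠ 1 ∨ (κ ^ 2) ^ 4 ≠ 1 := by rw [← pow_mul, ← pow_mul]; exact h8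
  have h334 : (π ^ 2) ^ 334 ≠ 1 ∨ (κ ^ 2) ^ 334 ≠ 1 := by rw [← pow_mul, ← pow_mul]; exact h668
  obtain ⟨hr, -⟩ := hadamard668_order668_cycle hH hι haut2 h1 h2 h4 h334
  exact sq_not_cycle668 hι π hπ hr

/-- **The `167`-column of the order table.**  If `167` divides the order `N` of the permutation pair of a signed automorphism of a
Hadamard matrix of order `668`, then `N ∈ {167, 334, 668}`. -/
theorem hadamard668_signedAut_orderOf_of_167_dvd (hH : IsHadamardMatrix H) (hι : Fintype.card ι = 668)
    (π κ : Equiv.Perm ι) (d e : ι → ℤ) (haut : IsSignedAut H π κ d e)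
    (h167 : 167 ∣ orderOf ((π, κ) : Equiv.Perm ι × Equiv.Perm ι)) :
    orderOf ((π, κ) : Equiv.Perm ι × Equiv.Perm ι) = 167 ∨ orderOf ((π, κ) : Equiv.Perm ι × Equiv.Perm ι) = 334 ∨
      orderOf ((π, κ) : Equiv.Perm ι × Equiv.Perm ι) = 668 := by
  set x : Equiv.Perm ι × Equiv.Perm ι := (π, κ) with hx
  set N := orderOf x with hN
  have hN0 : N ≠ 0 := (orderOf_pos x).ne'
  -- every prime divisor of N is a spectrum prime
  have hprime : ∀ p : ℕ, p.Prime → p ∣ N → p ∈ ({2, 3, 5, 7, 11, 13, 23, 37, 41, 83, 167} : Finset ℕ) := by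
    intro p hp hpN
    have hord : orderOf (x ^ (N / p)) = p := orderOf_pow_orderOf_div hN0 hpN
    have hxk : x ^ (N / p) = ((π ^ (N / p), κ ^ (N / p)) : Equiv.Perm ι × Equiv.Perm ι) := by rw [hx, Prod.pow_mk]
    rw [hxk] at hord
    obtain ⟨hp1, hp2, hne⟩ := pow_data_of_orderOf hord (a := 1) one_pos hp.one_lt
    rw [pow_one, pow_one] at hne
    exact hadamard668_signedAut_prime_mem' hH hι p hp _ _ _ _ (isSignedAut_pow haut (N / p)) hp1 hp2 hne
  -- no odd prime other than 167 divides N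
  have hodd : ∀ p : ℕ, p.Prime → p ∣ N → p = 2 ∨ p = 167 := by
    intro p hp hpN
    have hmem := hprime p hp hpN
    simp only [Finset.mem_insert, Finset.mem_singleton] at hmem
    have hsl : ∀ q : ℕ, (q, 167) ∈ ([(5, 37), (7, 37), (11, 37), (7, 41), (11, 41), (3, 83), (5, 83), (7, 83), (11, 83),
        (3, 167), (5, 167), (7, 167), (11, 167)] : List (ℕ × ℕ)) → q ∣ N → False := by
      intro q hq hqN
      have hq167 : q ≠ 167 := by
        simp only [List.mem_cons, Prod.mk.injEq, List.mem_nil_iff, or_false] at hq; omega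
      have hqp : q = 3 ∨ q = 5 ∨ q = 7 ∨ q = 11 := by
        simp only [List.mem_cons, Prod.mk.injEq, List.mem_nil_iff, or_false] at hq; omega
      have hcop : Nat.Coprime q 167 := by
        rcases hqp with rfl | rfl | rfl | rfl <;> norm_num
      exact no_hadamard668_signedAut_order_small_large hH hι π κ d e haut hq (Nat.Coprime.mul_dvd_of_dvd_of_dvd hcop hqN h167)
    have hbig : ∀ q : ℕ, q.Prime → 13 ≤ q → q ≠ 167 → q ∣ N → False := by
      intro q hq hq13 hq167 hqN
      have hcop : Nat.Coprime q 167 := (Nat.coprime_primes hq (by norm_num)).mpr hq167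
      exact no_hadamard668_signedAut_order_two_primes_ge_13 hH hι π κ d e haut hq (by norm_num) hq167 hq13 (by norm_num)
        (Nat.Coprime.mul_dvd_of_dvd_of_dvd hcop hqN h167)
    rcases hmem with h | h | h | h | h | h | h | h | h | h | h
    · exact Or.inl h
    · exact (hsl 3 (by decide) (h ▸ hpN)).elim
    · exact (hsl 5 (by decide) (h ▸ hpN)).elim
    · exact (hsl 7 (by decide) (h ▸ hpN)).elim
    · exact (hsl 11 (by decide) (h ▸ hpN)).elim
    · exact (hbig p hp (by omega) (by omega) hpN).elim
    · exact (hbig p hp (by omega) (by omega) hpN).elim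
    · exact (hbig p hp (by omega) (by omega) hpN).elim
    · exact (hbig p hp (by omega) (by omega) hpN).elim
    · exact (hbig p hp (by omega) (by omega) hpN).elim
    · exact Or.inr h
  -- 167² ∤ N and 1336 ∤ N
  have hsq : ¬ 167 * 167 ∣ N := fun h =>
    hadamard668_signedAut_not_dvd_orderOf_sq hH hι π κ d e haut (p := 167) (by norm_num) h
  have h1336 : ¬ 1336 ∣ N := by
    intro h
    have hord : orderOf (x ^ (N / 1336)) = 1336 := orderOf_pow_orderOf_div hN0 h
    have hxk : x ^ (N / 1336) = ((π ^ (N / 1336), κ ^ (N / 1336)) : Equiv.Perm ι × Equiv.Perm ι) := by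
      rw [hx, Prod.pow_mk]
    rw [hxk] at hord
    obtain ⟨hp1, hp2, h8⟩ := pow_data_of_orderOf hord (a := 8) (by norm_num) (by norm_num)
    obtain ⟨-, -, h668⟩ := pow_data_of_orderOf hord (a := 668) (by norm_num) (by norm_num)
    exact no_hadamard668_signedAut_order1336 hH hι (isSignedAut_pow haut (N / 1336)) hp1 hp2 h8 h668
  -- N = 167 · 2^v with v ≤ 2
  obtain ⟨m, hm⟩ := h167
  have hm0 : m ≠ 0 := by intro h; rw [h, mul_zero] at hm; exact hN0 hm
  obtain ⟨v, o, ho, hmo⟩ := Nat.exists_eq_two_pow_mul_odd hm0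
  have ho1 : o = 1 := by
    by_contra ho1
    obtain ⟨p, hp, hpo⟩ := Nat.exists_prime_and_dvd ho1
    have hpN : p ∣ N := by
      rw [hm, hmo]; exact Dvd.dvd.mul_left (Dvd.dvd.mul_left hpo _) _
    rcases hodd p hp hpN with rfl | rfl
    · -- 2 ∣ o, o odd
      exact (Nat.not_even_iff_odd.mpr ho) (even_iff_two_dvd.mpr hpo)
    · -- 167 ∣ o ⇒ 167² ∣ N
      apply hsq
      rw [hm, hmo]
      exact Nat.mul_dvd_mul_left 167 (Dvd.dvd.mul_left hpo _)
  rw [ho1, mul_one] at hmo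
  have hv : v ≤ 2 := by
    by_contra hv
    apply h1336
    rw [hm, hmo, show (1336 : ℕ) = 167 * 2 ^ 3 from rfl]
    exact Nat.mul_dvd_mul_left 167 (Nat.pow_dvd_pow 2 (by omega))
  interval_cases v
  · left; rw [hm, hmo]; norm_num
  · right; left; rw [hm, hmo]; norm_num
  · right; right; rw [hm, hmo]; norm_num

end Summit.Ventures.DiscreteObjects.Hadamard
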